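import Summits.BirchSwinnertonDyer.BirchSwinnertonDyer.Theorems.Rank2ObservatoryCubicFieldR1026540
import HarnessLib

/-!
# BirchSwinnertonDyer — rank ≥ 2 observatory: class number one of the cubic field of `-60 + 105 * X - 24 * X ^ 2 + X ^ 3` (`Δ = 1026540`) — certificates at the primes 283

HONEST FRAMING: per-curve certified theorems and census instruments; no claim on BSD in rank ≥ 2.

Companion of the per-FIELD file `Rank2ObservatoryCubicFieldR1026540` of the KERNEL-2DESC instrument (design
`b2b-bsdr2-cert-3/KERNEL-2DESC.md` §9e–§9g): the degree-one prime-element certificates at the primes 283 (part c).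
Split off for file size; generated by the same generator from the same checked data.
Sorry-free; axioms `propext`, `Classical.choice`, `Quot.sound`.
[cite: Marcus2018, Ch. 3 Thm. 27, Ch. 5 Cor. 2 of Thm. 37]
-/

-- single-conjunct summit: `Summit.BirchSwinnertonDyer.BirchSwinnertonDyer.…` repeats the name by design
set_option linter.dupNamespace false

noncomputable section

open scoped Classical NumberField

open Literature.NumberTheory.NumberFields Polynomial Module NumberField

namespace Summit.BirchSwinnertonDyer.BirchSwinnertonDyer.Rank2Observatory.TwoDescCubic

namespace FieldR1026540

/-! ## Class number one -/

/-- Certificate at `283`: every ring map `ψ : 𝓞 K → ℤ/283` kills a prime element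
(`α ↦ 30`: `3983017434643 - 6081146018011 * α + 224826687273 * α ^ 2` (norm `283`); `α ↦ 60`: `17981736795379 - 4698361394841 * α + 201818541353 * α ^ 2` (norm `283`); `α ↦ 217`: `19 - 4 * α` (norm `283`)). [cite: Marcus2018, Ch. 3, Thm. 27] -/
theorem cert283 (ψ : 𝓞 (CubicField (-24) 105 (-60)) →+* ZMod 283) : ∃ e : 𝓞 (CubicField (-24) 105 (-60)), ψ e = 0 ∧ Prime e := by
  refine cert_of_cases aeval_α ψ (fun t ht hF => ?_)
  have hroots : ∀ t : ZMod 283,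
      t ^ 3 + (((-24) : ℤ) : ZMod 283) * t ^ 2 + ((105 : ℤ) : ZMod 283) * t + (((-60) : ℤ) : ZMod 283) = 0 → t = 30 ∨ t = 60 ∨ t = 217 := by
    decide +kernel
  rcases hroots t hF with rfl | rfl | rfl
  · exact ⟨lin aeval_α 3983017434643 (-6081146018011) 224826687273, by simp only [lin, map_add, map_mul, map_pow, map_intCast, ht]; decide,
      lin_prime_of_prime irreducible aeval_α finrank_eq 3983017434643 (-6081146018011) 224826687273 (n := 283)
        (by norm_num [MonicCubic.normForm]) (by norm_num)⟩
  · exact ⟨lin aeval_α 17981736795379 (-4698361394841) 201818541353, by simp only [lin, map_add, map_mul, map_pow, map_intCast, ht]; decide,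
      lin_prime_of_prime irreducible aeval_α finrank_eq 17981736795379 (-4698361394841) 201818541353 (n := 283)
        (by norm_num [MonicCubic.normForm]) (by norm_num)⟩
  · exact ⟨lin aeval_α 19 (-4) 0, by simp only [lin, map_add, map_mul, map_pow, map_intCast, ht]; decide,
      lin_prime_of_prime irreducible aeval_α finrank_eq 19 (-4) 0 (n := 283)
        (by norm_num [MonicCubic.normForm]) (by norm_num)⟩

end FieldR1026540

end Summit.BirchSwinnertonDyer.BirchSwinnertonDyer.Rank2Observatory.TwoDescCubic

end
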